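import Summits.QuantumAdvantage.QuantumAdvantage.Theorems.CharDialTokenDialR
import HarnessLib

/-!
# WalkHardFJLinOdd — the token dial, part S: DEAD-SYMMETRIC PAIRS are invisible to every swap dial, and the PAIR LIFT is LOW

Cell `decomp-qadv`, lens 6, generation 19 (census / barrier supplement to REV3–REV5).  All four swap dials (flip, far-flip, separated,
and the token dials before them) are keyed to ONE statistic of an adjacent pair `(s, t = s+1)`: the set `flipAny y s t` of inputs with
`u_s ≠ u_t` whose win bit flips, for some charge, under the transposition.  ★ `flipAny_eq_empty_of_deadSym`: if every cut's decision is
invariant under the transposition on `{u_s ≠ u_t}` and the cut BETWEEN `s` and `t` rejects there, then `flipAny y s t = ∅` (the only walk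
exponent that moves is that of the dead cut) — the pair is DEAD-SYMMETRIC, has swap-influence mass `0` (so it is a LOW position at
every threshold), and every swap dial's richness clause fails at it; ★ `not_flipHyp_of_dead_or_crowded` (and `…farFlipHyp…`,
`…sepFlipHyp…`): a strategy that at EVERY adjacent pair is dead-symmetric or CROWDED (more than `K` cuts feel the transposition
somewhere) is outside the flip / far / separated dials at budget `K`, for every window and threshold.  ★ THE PAIR LIFT `twinLift a H` of form data `(a, H)` on `n` positions:
on `2n` positions, cut `2j` plays `H j` on the DOUBLED form `Σ_i a j i·(u_{2i} + u_{2i+1})`, the odd cuts are dead.  It is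
`JLinHyp`-presentable with empty juntas (`twinLift_jlin`), dead-symmetric at the `n` internal pairs (`twinLift_sym`, `twinLift_dead`), hence LOW at
EVERY threshold schedule (`twinLift_lowVar`) with `flipAny = ∅` at every internal pair (`twinLift_flipAny_internal`).  Census consequence
(NODE-g19-REV5 §3 / NEXT-g20 §3.4): the LOW class contains the pair lifts of arbitrary form strategies; no dial keyed to swap richness at
low pairs can separate them, so the LOW residual (item 27206) is closed by such dials only together with a law for lifted (alphabet
`{0,1,2}`) form strategies.
-/

set_option autoImplicit false

open Finset

namespace Summit.QuantumAdvantage.AdviceFreeQNC0.JLinPeel.TokenDial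

open SegMove

variable {n : ℕ}

section DeadPairs

/-- **no flip at a dead cut.** if every cut's decision is unchanged by the transposition of `u_s ≠ u_t` and the cut between `s` and `t`
rejects `u`, the win bit does not move (every other walk exponent is unchanged, `walkExp_swap_of_ne`). -/
theorem ringWinU_swap_eq_of_dead (c : ℕ) (y : Fin (n + 1) → (Fin n → Bool) → Bool) (u : Fin n → Bool) (s t : Fin n)
    (hst : t.val = s.val + 1) (hne : u s ≠ u t) (hsym : ∀ g, y g (segCompl u s.val (s.val + 2)) = y g u)
    (hdead : y (cut t) u = false) :
    ringWinU c y (segCompl u s.val (s.val + 2)) = ringWinU c y u := by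
  have hrest : ((univ.erase (cut t)).filter fun g : Fin (n + 1) =>
        y g (segCompl u s.val (s.val + 2)) = true ∧ (c + g.val + walkExp (segCompl u s.val (s.val + 2)) g.val) % 3 ≠ 0)
      = (univ.erase (cut t)).filter fun g : Fin (n + 1) => y g u = true ∧ (c + g.val + walkExp u g.val) % 3 ≠ 0 := by
    refine filter_congr fun g hg => ?_
    have hg' : g.val ≠ s.val + 1 := fun h => (ne_of_mem_erase hg) (Fin.ext (by rw [cut_val]; omega))
    rw [hsym g, walkExp_swap_of_ne u s t hst hne hg']
  have e1 := flc_split c y (segCompl u s.val (s.val + 2)) (cut t)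
  have e2 := flc_split c y u (cut t)
  rw [hrest, hsym (cut t), hdead] at e1
  rw [hdead] at e2
  simp only [Bool.false_eq_true, false_and, if_false, zero_add] at e1 e2
  rw [ringWinU_eq_decide, ringWinU_eq_decide, e1, e2]

/-- ★ **a dead-symmetric pair has no flips**: `flipAny y s t = ∅`. -/
theorem flipAny_eq_empty_of_deadSym (y : Fin (n + 1) → (Fin n → Bool) → Bool) (s t : Fin n) (hst : t.val = s.val + 1)
    (hsym : ∀ g u, u s ≠ u t → y g (segCompl u s.val (s.val + 2)) = y g u) (hdead : ∀ u, u s ≠ u t → y (cut t) u = false) :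
    flipAny y s t = ∅ := by
  unfold flipAny
  rw [filter_eq_empty_iff]
  rintro u - ⟨hne, hc⟩
  have h := fun c => ringWinU_swap_eq_of_dead c y u s t hst hne (fun g => hsym g u hne) (hdead u hne)
  rcases hc with h0 | h1 | h2
  · exact h0 (h 0)
  · exact h1 (h 1)
  · exact h2 (h 2)

/-- hence every swap dial's richness clause `2ⁿ ≤ 4p·#flipAny` FAILS at a dead-symmetric pair. -/
theorem not_rich_of_deadSym (p : ℕ) (y : Fin (n + 1) → (Fin n → Bool) → Bool) (s t : Fin n) (hst : t.val = s.val + 1)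
    (hsym : ∀ g u, u s ≠ u t → y g (segCompl u s.val (s.val + 2)) = y g u) (hdead : ∀ u, u s ≠ u t → y (cut t) u = false) :
    ¬ 2 ^ n ≤ 4 * p * (univ.filter fun u : Fin n → Bool => u s ≠ u t ∧
      (ringWinU 0 y (segCompl u s.val (s.val + 2)) ≠ ringWinU 0 y u ∨
        ringWinU 1 y (segCompl u s.val (s.val + 2)) ≠ ringWinU 1 y u ∨
          ringWinU 2 y (segCompl u s.val (s.val + 2)) ≠ ringWinU 2 y u)).card := by
  have h := flipAny_eq_empty_of_deadSym y s t hst hsym hdead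
  unfold flipAny at h
  rw [h, card_empty, mul_zero]
  have := Nat.one_le_two_pow (n := n)
  omega

/-- a swap-symmetric cut has swap influence `0` at the pair. -/
theorem swapInf_eq_zero_of_sym (y : Fin (n + 1) → (Fin n → Bool) → Bool) (g : Fin (n + 1)) (s t : Fin n)
    (hst : t.val = s.val + 1) (hsym : ∀ u, u s ≠ u t → y g (segCompl u s.val (s.val + 2)) = y g u) :
    swapInf y g s.val = 0 := by
  unfold swapInf
  rw [card_eq_zero, filter_eq_empty_iff]
  rintro u - ⟨hadj, hch⟩
  obtain ⟨s', t', hs', ht', hne⟩ := (neAdj_iff u _).1 hadj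
  have hs : s' = s := Fin.ext (by omega)
  have ht : t' = t := Fin.ext (by omega)
  rw [hs, ht] at hne
  exact hch (hsym u hne)

/-- a swap-symmetric pair is a LOW position at every threshold. -/
theorem mem_lowPositions_of_sym (y : Fin (n + 1) → (Fin n → Bool) → Bool) (s t : Fin n) (hst : t.val = s.val + 1)
    (hsym : ∀ g u, u s ≠ u t → y g (segCompl u s.val (s.val + 2)) = y g u) (B : ℕ) :
    s.val ∈ lowPositions n y B := by
  unfold lowPositions
  rw [mem_filter, mem_range]
  refine ⟨s.isLt, ?_⟩
  unfold swapMass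
  rw [sum_eq_zero fun g _ => swapInf_eq_zero_of_sym y g s t hst (hsym g)]
  exact Nat.zero_le _

/-- ★ a strategy that is swap-symmetric at a set `P` of left endpoints with `n ≤ 2·#P` is LOW at every threshold schedule. -/
theorem lowVar_of_sym (y : Fin (n + 1) → (Fin n → Bool) → Bool) (P : Finset (Fin n))
    (hP : ∀ s ∈ P, ∃ t : Fin n, t.val = s.val + 1 ∧ ∀ g u, u s ≠ u t → y g (segCompl u s.val (s.val + 2)) = y g u)
    (hn : n ≤ 2 * P.card) (B : ℕ → ℕ) : TowerDefs.LowVar B n y := by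
  unfold TowerDefs.LowVar
  have hsub : P.image (fun s : Fin n => s.val) ⊆ lowPositions n y (B n) := by
    intro i hi
    rw [mem_image] at hi
    obtain ⟨s, hs, rfl⟩ := hi
    obtain ⟨t, hst, hsym⟩ := hP s hs
    exact mem_lowPositions_of_sym y s t hst hsym (B n)
  have hc := card_le_card hsub
  rw [card_image_of_injective _ Fin.val_injective] at hc
  omega

/-- ★ **the two escapes from the flip dial, pairwise**: if at EVERY adjacent pair the strategy is either dead-symmetric or CROWDED (more
than `K` cuts each feel the transposition at some input), then `¬ FlipHyp p K w y` — whatever the window `w`. -/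
theorem not_flipHyp_of_dead_or_crowded (p K w : ℕ) (y : Fin (n + 1) → (Fin n → Bool) → Bool)
    (h : ∀ s t : Fin n, t.val = s.val + 1 →
      ((∀ g u, u s ≠ u t → y g (segCompl u s.val (s.val + 2)) = y g u) ∧ (∀ u, u s ≠ u t → y (cut t) u = false)) ∨
      ∃ C : Finset (Fin (n + 1)), K < C.card ∧ ∀ g ∈ C, ∃ u : Fin n → Bool, u s ≠ u t ∧ y g (segCompl u s.val (s.val + 2)) ≠ y g u) :
    ¬ TowerDefs.FlipHyp p K w y := by
  rintro ⟨s, t, hst, G, hG, -, hS, hrich⟩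
  rcases h s t hst with ⟨hsym, hdead⟩ | ⟨C, hC, hmov⟩
  · exact not_rich_of_deadSym p y s t hst hsym hdead hrich
  · have hCG : C ⊆ G := fun g hg => by
      by_contra hgG
      obtain ⟨u, hne, hch⟩ := hmov g hg
      exact hch (hS g hgG u hne)
    have := card_le_card hCG
    omega

/-- ★ the same two escapes defeat the FAR dial (every `w`, `L`). -/
theorem not_farFlipHyp_of_dead_or_crowded (p K w L : ℕ) (y : Fin (n + 1) → (Fin n → Bool) → Bool)
    (h : ∀ s t : Fin n, t.val = s.val + 1 →
      ((∀ g u, u s ≠ u t → y g (segCompl u s.val (s.val + 2)) = y g u) ∧ (∀ u, u s ≠ u t → y (cut t) u = false)) ∨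
      ∃ C : Finset (Fin (n + 1)), K < C.card ∧ ∀ g ∈ C, ∃ u : Fin n → Bool, u s ≠ u t ∧ y g (segCompl u s.val (s.val + 2)) ≠ y g u) :
    ¬ TowerDefs.FarFlipHyp p K w L y := by
  rintro ⟨s, t, hst, R, hR, m, -, far, -, -, hS, hrich⟩
  rcases h s t hst with ⟨hsym, hdead⟩ | ⟨C, hC, hmov⟩
  · exact not_rich_of_deadSym p y s t hst hsym hdead hrich
  · have hCR : C ⊆ R := fun g hg => by
      by_contra hgR
      obtain ⟨u, hne, hch⟩ := hmov g hg
      exact hch (hS g hgR u hne)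
    have := card_le_card hCR
    omega

/-- ★ … and the SEPARATED-READER dial (every `w`, `L`). -/
theorem not_sepFlipHyp_of_dead_or_crowded (p K w L : ℕ) (y : Fin (n + 1) → (Fin n → Bool) → Bool)
    (h : ∀ s t : Fin n, t.val = s.val + 1 →
      ((∀ g u, u s ≠ u t → y g (segCompl u s.val (s.val + 2)) = y g u) ∧ (∀ u, u s ≠ u t → y (cut t) u = false)) ∨
      ∃ C : Finset (Fin (n + 1)), K < C.card ∧ ∀ g ∈ C, ∃ u : Fin n → Bool, u s ≠ u t ∧ y g (segCompl u s.val (s.val + 2)) ≠ y g u) :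
    ¬ TowerDefs.SepFlipHyp p K w L y := by
  rintro ⟨s, t, hst, R, hR, m, -, far, -, -, -, -, hS, hrich⟩
  rcases h s t hst with ⟨hsym, hdead⟩ | ⟨C, hC, hmov⟩
  · exact not_rich_of_deadSym p y s t hst hsym hdead hrich
  · have hCR : C ⊆ R := fun g hg => by
      by_contra hgR
      obtain ⟨u, hne, hch⟩ := hmov g hg
      exact hch (hS g hgR u hne)
    have := card_le_card hCR
    omega

end DeadPairs

/-! ### the PAIR LIFT of form data: doubled forms, dead odd cuts -/

section PairLift

variable {p : ℕ}

/-- the cut index of the base game read by lifted cut `g` (`⌊g/2⌋`). -/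
def twinCut (g : Fin (2 * n + 1)) : Fin (n + 1) := ⟨g.val / 2, by omega⟩

/-- the base position under lifted position `k` (`⌊k/2⌋`). -/
def twinPos (k : Fin (2 * n)) : Fin n := ⟨k.val / 2, by omega⟩

/-- the DOUBLED form of lifted cut `g`: both positions of block `i` carry the coefficient `a ⌊g/2⌋ i`. -/
def twinForm (a : Fin (n + 1) → Fin n → ZMod p) (g : Fin (2 * n + 1)) : Fin (2 * n) → ZMod p :=
  fun k => a (twinCut g) (twinPos k)

/-- ★ **the PAIR LIFT** of form data `(a, H)`: even cut `2j` plays `H j` on the doubled form (`Σ_i a j i·(u_{2i} + u_{2i+1})`), odd cuts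
are dead. -/
def twinLift (a : Fin (n + 1) → Fin n → ZMod p) (H : Fin (n + 1) → ZMod p → Bool) :
    Fin (2 * n + 1) → (Fin (2 * n) → Bool) → Bool :=
  fun g u => if g.val % 2 = 1 then false else H (twinCut g) (∑ k, if u k then twinForm a g k else 0)

/-- the lift is `JLinHyp`-presentable with EMPTY juntas. -/
theorem twinLift_jlin (a : Fin (n + 1) → Fin n → ZMod p) (H : Fin (n + 1) → ZMod p → Bool) :
    TowerDefs.JLinHyp p (2 * n) (twinLift a H) := by
  intro g
  refine ⟨∅, by simp, twinForm a g, fun _ s => if g.val % 2 = 1 then false else H (twinCut g) s, fun _ _ _ _ => rfl,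
    fun u => ?_⟩
  rfl

/-- the transposition of two unequal adjacent bits is the coordinate swap. -/
theorem segCompl_eq_swap (u : Fin n → Bool) (s t : Fin n) (hst : t.val = s.val + 1) (hne : u s ≠ u t) (k : Fin n) :
    segCompl u s.val (s.val + 2) k = u (Equiv.swap s t k) := by
  by_cases hks : k = s
  · subst hks
    rw [Equiv.swap_apply_left, swap_apply_s]
    cases h1 : u k <;> cases h2 : u t <;> simp_all
  · by_cases hkt : k = t
    · subst hkt
      rw [Equiv.swap_apply_right, segCompl_apply, if_pos ⟨by omega, by omega⟩]
      cases h1 : u s <;> cases h2 : u k <;> simp_all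
    · have hk : ¬ (s.val ≤ k.val ∧ k.val < s.val + 2) := by
        intro h
        rcases Nat.lt_or_ge k.val (s.val + 1) with h1 | h1
        · exact hks (Fin.ext (by omega))
        · exact hkt (Fin.ext (by omega))
      rw [segCompl_of_not_mem u k hk, Equiv.swap_apply_of_ne_of_ne hks hkt]

/-- the doubled form is invariant under the transposition of an internal pair `(2j, 2j+1)`. -/
theorem twinForm_sum_swap (a : Fin (n + 1) → Fin n → ZMod p) (g : Fin (2 * n + 1)) (u : Fin (2 * n) → Bool)
    (s t : Fin (2 * n)) (j : ℕ) (hs : s.val = 2 * j) (ht : t.val = 2 * j + 1) (hne : u s ≠ u t) :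
    (∑ k, if segCompl u s.val (s.val + 2) k then twinForm a g k else 0) = ∑ k, if u k then twinForm a g k else 0 := by
  have hst : t.val = s.val + 1 := by omega
  have hcs : twinForm a g s = twinForm a g t := by
    unfold twinForm twinPos
    congr 2
    omega
  have hc : ∀ k, twinForm a g (Equiv.swap s t k) = twinForm a g k := by
    intro k
    by_cases hks : k = s
    · rw [hks, Equiv.swap_apply_left, hcs]
    · by_cases hkt : k = t
      · rw [hkt, Equiv.swap_apply_right, hcs]
      · rw [Equiv.swap_apply_of_ne_of_ne hks hkt]
  simp_rw [segCompl_eq_swap u s t hst hne]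
  calc (∑ k, if u (Equiv.swap s t k) then twinForm a g k else 0)
      = ∑ k, (if u (Equiv.swap s t k) then twinForm a g (Equiv.swap s t k) else 0) := by
        refine sum_congr rfl fun k _ => ?_; rw [hc k]
    _ = ∑ k, if u k then twinForm a g k else 0 :=
        Equiv.sum_comp (Equiv.swap s t) (fun k => if u k then twinForm a g k else 0)

/-- ★ the lift is SWAP-SYMMETRIC at every internal pair. -/
theorem twinLift_sym (a : Fin (n + 1) → Fin n → ZMod p) (H : Fin (n + 1) → ZMod p → Bool) (s t : Fin (2 * n)) (j : ℕ)
    (hs : s.val = 2 * j) (ht : t.val = 2 * j + 1) :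
    ∀ g u, u s ≠ u t → twinLift a H g (segCompl u s.val (s.val + 2)) = twinLift a H g u := by
  intro g u hne
  unfold twinLift
  split_ifs with hg
  · rfl
  · rw [twinForm_sum_swap a g u s t j hs ht hne]

/-- ★ the cut between an internal pair is DEAD. -/
theorem twinLift_dead (a : Fin (n + 1) → Fin n → ZMod p) (H : Fin (n + 1) → ZMod p → Bool) (t : Fin (2 * n)) (j : ℕ)
    (ht : t.val = 2 * j + 1) : ∀ u, twinLift a H (cut t) u = false := by
  intro u
  unfold twinLift
  rw [if_pos]
  rw [cut_val]; omega

/-- ★★ **the pair lift is LOW at every threshold schedule** (all `n` internal pairs have swap mass `0`). -/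
theorem twinLift_lowVar (a : Fin (n + 1) → Fin n → ZMod p) (H : Fin (n + 1) → ZMod p → Bool) (B : ℕ → ℕ) :
    TowerDefs.LowVar B (2 * n) (twinLift a H) := by
  classical
  refine lowVar_of_sym (twinLift a H) (univ.image fun j : Fin n => (⟨2 * j.val, by omega⟩ : Fin (2 * n))) ?_ ?_ B
  · intro s hs
    rw [mem_image] at hs
    obtain ⟨j, -, rfl⟩ := hs
    exact ⟨⟨2 * j.val + 1, by omega⟩, rfl, twinLift_sym a H _ _ j.val rfl rfl⟩
  · rw [card_image_of_injective _ (fun j j' h => Fin.ext (by have := Fin.mk.inj_iff.mp h; omega)), card_univ,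
      Fintype.card_fin]

/-- ★★ **the pair lift has NO FLIPS at any internal pair**: `flipAny (twinLift a H) (2j) (2j+1) = ∅`. -/
theorem twinLift_flipAny_internal (a : Fin (n + 1) → Fin n → ZMod p) (H : Fin (n + 1) → ZMod p → Bool) (s t : Fin (2 * n))
    (j : ℕ) (hs : s.val = 2 * j) (ht : t.val = 2 * j + 1) : flipAny (twinLift a H) s t = ∅ :=
  flipAny_eq_empty_of_deadSym (twinLift a H) s t (by omega) (twinLift_sym a H s t j hs ht)
    (fun u _ => twinLift_dead a H t j ht u)

/-- ★★ hence every swap dial's richness clause fails at every internal pair of the lift (all `p`). -/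
theorem twinLift_not_rich_internal (p' : ℕ) (a : Fin (n + 1) → Fin n → ZMod p) (H : Fin (n + 1) → ZMod p → Bool)
    (s t : Fin (2 * n)) (j : ℕ) (hs : s.val = 2 * j) (ht : t.val = 2 * j + 1) :
    ¬ 2 ^ (2 * n) ≤ 4 * p' * (univ.filter fun u : Fin (2 * n) → Bool => u s ≠ u t ∧
      (ringWinU 0 (twinLift a H) (segCompl u s.val (s.val + 2)) ≠ ringWinU 0 (twinLift a H) u ∨
        ringWinU 1 (twinLift a H) (segCompl u s.val (s.val + 2)) ≠ ringWinU 1 (twinLift a H) u ∨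
          ringWinU 2 (twinLift a H) (segCompl u s.val (s.val + 2)) ≠ ringWinU 2 (twinLift a H) u)).card :=
  not_rich_of_deadSym p' (twinLift a H) s t (by omega) (twinLift_sym a H s t j hs ht) (fun u _ => twinLift_dead a H t j ht u)

end PairLift

end Summit.QuantumAdvantage.AdviceFreeQNC0.JLinPeel.TokenDial
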